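import Mathlib
import Summits.ValiantsHypothesis.ValiantsHypothesis.Theorems.FifoMatchingNNNotVPSupportFnCore
import Summits.ValiantsHypothesis.ValiantsHypothesis.Theorems.FifoMatchingNNNotVPStubCertificateToSupportFn
import Literature.Computability.AlgebraicComplexity.NestFreeMatchingPoly
import HarnessLib

/-!
# Route FifoMatching — crux `NNDivisionHard` (stmt-ValiantsHypothesis-21181):
# closure properties of the DOMINATED cofactor class (the class decided by the Boolean-shadow rung)

The Boolean-shadow domination rung (`NNDivisionHard.ShadowDominated.nnDivisionHard_of_freedDominated`,
✓ p823553) decides every cofactor `h` that is *dominated with the arcs of `T` freed* for some arc set `T`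
of polylogarithmic size:

  `∀ A, SuppFn (NN_n|_{T:=1}) A → SuppFn (h|_{T:=1}) A`.

This route-independent file (no `Theses` import) records that, for a FIXED `T`, the dominated cofactors
form an UPPER, MULTIPLICATIVELY CLOSED class — so the decided population is large and robust:

* `suppFn_add_iff` — the shadow of a sum over `ℝ≥0` is the disjunction of the shadows;
* `freedDominated_add_left` / `freedDominated_add_right` — `h` dominated ⇒ `h + h'` and `h' + h` dominated
  (adding ANY nonnegative polynomial keeps domination);
* `freedDominated_mul` — `h₁, h₂` dominated ⇒ `h₁ · h₂` dominated; `freedDominated_pow`;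
* `freedDominated_of_forall_suppFn` / `freedDominated_of_coeff_zero_ne_zero` — identically-true shadows
  (e.g. a nonzero constant term) are dominated for every `T`;
* `freedDominated_mono` — domination is MONOTONE in the free set: dominated at `T ⊆ T'` ⇒ dominated at `T'`.

Honest framing: bookkeeping for the decided class of 21181 (which cofactors the rung removes from the
residual); `NNDivisionHard`, `NNNotVP` and `VP ≠ VNP` stay OPEN (NOT proved).  No definitions (the
domination hypothesis is spelled out inline), no named facts.
-/

noncomputable section

-- Sub = Summit single-conjunct layout: the duplicated namespace component is mandated by the tree.
set_option linter.dupNamespace false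
set_option autoImplicit false

namespace Summit.ValiantsHypothesis.ValiantsHypothesis.Theorems.FifoMatching.NNDivisionHard.DominatedClosure

open MvPolynomial Finset Literature.Computability.AlgebraicComplexity
open scoped NNReal BigOperators Classical
open Summit.ValiantsHypothesis.ValiantsHypothesis.Theorems.FifoMatching.NNNotVP.DivisionSplit
  (σ NN SuppFn freeVars suppFn_iff_eval_ne_zero suppFn_freeVars_iff freeVars_mul)

variable {τ : Type*}

/-! ### §1 Shadow calculus over `ℝ≥0` -/

/-- **The shadow of a sum over `ℝ≥0`**: `SuppFn (f + g) A ↔ SuppFn f A ∨ SuppFn g A`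
(`(f+g)(1_A) = f(1_A) + g(1_A)` is a sum of nonnegative reals). [folklore] -/
theorem suppFn_add_iff (f g : MvPolynomial τ ℝ≥0) (A : Finset τ) :
    SuppFn (f + g) A ↔ SuppFn f A ∨ SuppFn g A := by
  rw [suppFn_iff_eval_ne_zero, suppFn_iff_eval_ne_zero, suppFn_iff_eval_ne_zero, map_add, Ne,
    add_eq_zero, not_and_or]

/-- `freeVars T` is additive. [folklore] -/
theorem freeVars_add (T : Finset τ) (f g : MvPolynomial τ ℝ≥0) :
    freeVars T (f + g) = freeVars T f + freeVars T g := by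
  unfold freeVars
  exact map_add _ _ _

/-- `freeVars T` commutes with powers. [folklore] -/
theorem freeVars_pow (T : Finset τ) (f : MvPolynomial τ ℝ≥0) (D : ℕ) :
    freeVars T (f ^ D) = freeVars T f ^ D := by
  unfold freeVars
  exact map_pow _ _ _

/-! ### §2 The dominated class is an upper set -/

/-- **Adding anything keeps domination (left summand dominated).** [folklore] -/
theorem freedDominated_add_left {n : ℕ} {T : Finset (σ n)} {h : MvPolynomial (σ n) ℝ≥0}
    (hdom : ∀ A : Finset (σ n), SuppFn (freeVars T (NN n)) A → SuppFn (freeVars T h) A)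
    (h' : MvPolynomial (σ n) ℝ≥0) :
    ∀ A : Finset (σ n), SuppFn (freeVars T (NN n)) A → SuppFn (freeVars T (h + h')) A := by
  intro A hA
  rw [freeVars_add, suppFn_add_iff]
  exact Or.inl (hdom A hA)

/-- **Adding anything keeps domination (right summand dominated).** [folklore] -/
theorem freedDominated_add_right {n : ℕ} {T : Finset (σ n)} {h : MvPolynomial (σ n) ℝ≥0}
    (hdom : ∀ A : Finset (σ n), SuppFn (freeVars T (NN n)) A → SuppFn (freeVars T h) A)
    (h' : MvPolynomial (σ n) ℝ≥0) :
    ∀ A : Finset (σ n), SuppFn (freeVars T (NN n)) A → SuppFn (freeVars T (h' + h)) A := by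
  intro A hA
  rw [freeVars_add, suppFn_add_iff]
  exact Or.inr (hdom A hA)

/-! ### §3 The dominated class is multiplicatively closed -/

/-- **Products of dominated cofactors are dominated** (the shadow of a product over `ℝ≥0` is the
conjunction of the shadows, cf. `ShadowDominated.suppFn_mul_iff`). [folklore] -/
theorem freedDominated_mul {n : ℕ} {T : Finset (σ n)} {h₁ h₂ : MvPolynomial (σ n) ℝ≥0}
    (h₁dom : ∀ A : Finset (σ n), SuppFn (freeVars T (NN n)) A → SuppFn (freeVars T h₁) A)
    (h₂dom : ∀ A : Finset (σ n), SuppFn (freeVars T (NN n)) A → SuppFn (freeVars T h₂) A) :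
    ∀ A : Finset (σ n), SuppFn (freeVars T (NN n)) A → SuppFn (freeVars T (h₁ * h₂)) A := by
  intro A hA
  have h1 := h₁dom A hA
  have h2 := h₂dom A hA
  rw [suppFn_iff_eval_ne_zero] at h1 h2
  rw [freeVars_mul, suppFn_iff_eval_ne_zero, map_mul]
  exact mul_ne_zero h1 h2

/-- **Powers of a dominated cofactor are dominated.** [folklore] -/
theorem freedDominated_pow {n : ℕ} {T : Finset (σ n)} {h : MvPolynomial (σ n) ℝ≥0}
    (hdom : ∀ A : Finset (σ n), SuppFn (freeVars T (NN n)) A → SuppFn (freeVars T h) A) (D : ℕ) :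
    ∀ A : Finset (σ n), SuppFn (freeVars T (NN n)) A → SuppFn (freeVars T (h ^ D)) A := by
  intro A hA
  have hh := hdom A hA
  rw [suppFn_iff_eval_ne_zero] at hh
  rw [freeVars_pow, suppFn_iff_eval_ne_zero, map_pow]
  exact pow_ne_zero D hh

/-! ### §4 Identically-true shadows; monotonicity in the free set -/

/-- **An identically-true shadow is dominated for every `T`** (freeing arcs only enlarges the tested
arc set: `SuppFn (g|_{T:=1}) A ↔ SuppFn g (T ∪ A)`). [folklore] -/
theorem freedDominated_of_forall_suppFn {n : ℕ} (T : Finset (σ n)) {h : MvPolynomial (σ n) ℝ≥0}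
    (hall : ∀ B : Finset (σ n), SuppFn h B) :
    ∀ A : Finset (σ n), SuppFn (freeVars T (NN n)) A → SuppFn (freeVars T h) A := by
  intro A _
  rw [suppFn_freeVars_iff]
  exact hall _

/-- **A nonzero constant term makes a cofactor dominated for every `T`.** [folklore] -/
theorem freedDominated_of_coeff_zero_ne_zero {n : ℕ} (T : Finset (σ n))
    {h : MvPolynomial (σ n) ℝ≥0} (h0 : coeff 0 h ≠ 0) :
    ∀ A : Finset (σ n), SuppFn (freeVars T (NN n)) A → SuppFn (freeVars T h) A :=
  freedDominated_of_forall_suppFn T fun B => ⟨0, mem_support_iff.2 h0, by simp⟩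

/-- **Domination is monotone in the free set**: dominated with `T` freed and `T ⊆ T'` ⇒ dominated
with `T'` freed (`T ∪ (T' ∪ A)` and `T' ∪ A` sandwich each other). [folklore] -/
theorem freedDominated_mono {n : ℕ} {T T' : Finset (σ n)} (hTT' : T ⊆ T')
    {h : MvPolynomial (σ n) ℝ≥0}
    (hdom : ∀ A : Finset (σ n), SuppFn (freeVars T (NN n)) A → SuppFn (freeVars T h) A) :
    ∀ A : Finset (σ n), SuppFn (freeVars T' (NN n)) A → SuppFn (freeVars T' h) A := by
  intro A hA
  rw [suppFn_freeVars_iff] at hA ⊢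
  have h1 : SuppFn (freeVars T (NN n)) (T' ∪ A) := by
    rw [suppFn_freeVars_iff]
    refine hA.mono fun x hx => ?_
    simp only [Finset.mem_union] at hx ⊢
    exact Or.inr hx
  have h2 := hdom _ h1
  rw [suppFn_freeVars_iff] at h2
  refine h2.mono fun x hx => ?_
  simp only [Finset.mem_union] at hx ⊢
  rcases hx with hx | hx
  · exact Or.inl (hTT' hx)
  · exact hx

end Summit.ValiantsHypothesis.ValiantsHypothesis.Theorems.FifoMatching.NNDivisionHard.DominatedClosure

end
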